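import Literature.MathematicalPhysics.QuantumFieldTheory.Balaban1983to89.B9Thm31CubeLocalFlat
import Literature.MathematicalPhysics.QuantumFieldTheory.Balaban1983to89.B6Prop22DualHolderMultiLevelTorusL0

/-!
# `Balaban1983to89.B9Thm31HolderCubeLocalFlat` — [B9] THEOREM 3.1, THE HÖLDER ENTRIES (3.43), AT `U = 1` FOR THE CUBE-LOCAL LETTER `G′_□`
# OF SECT. C (p. 409) AT THE def-Y-COMPATIBLE WEIGHTS `wCube`: `‖ζ∇G′_□λ‖_α` and `‖ζG′_□∇*λ‖_α` with an `α`-UNIFORM decay rate —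
# BY NAME from the `…L0` lineage (`prop22_fourth ∕ fifth_multiLevelTorus_unif`) at the cube family of `B9CubeSequence408`
# (sub-row G-B9-LETTERS, module M5.1a, file 2b)

FRAMING (verbatim cell line):
statement-level skeleton of published theorems with citation tags; proofs where landed; nothing here is a claim about the Yang–Mills mass gap

Sources under audit (cell lit-balaban): T. Bałaban, *Propagators for lattice gauge theories in a background field*, Commun. Math. Phys. **99**
(1985) 389–434 [`Balaban1985BackgroundPropagators`, "B9"], Thm 3.1 p. 397 with (3.43) p. 398, Cor. 3.5 p. 407, p. 409 l. 1–5; T. Bałaban, *Propagators and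
renormalization transformations for lattice gauge theories. II*, Commun. Math. Phys. **96** (1984) 223–250 [`Balaban1984PropagatorsII`, "[4]"],
Prop. 2.2 (2.67) p. 234 (fourth and fifth entries), (2.64)–(2.66) p. 234.  Unit `lit-balaban-r05` (r05 gen 77); B9 fold owner r06, B6 fold r03.

## WHAT IS PRINTED (verbatim up to notation)

[B9] Thm 3.1 (3.43) p. 398 (verbatim from the render, r06 crop `lean/g63/crops/p398_343.png`): «‖ζ∇_UG′(U)λ‖_α, ‖ζG′(U)∇*_Uλ‖_α ≦
B₀(β₀)(L^jη)^{1−α}(‖ζ‖^ξ_β + |ζ|)e^{−δ₀d(y,y′)}|λ|» for «ζ ∈ C₀^∞(Δ̃(y))» (Δ̃(y) = the `2Lʲη`-cube centred at `y`), the cut-off norm `‖ζ‖^ξ_β` taken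
on the `ξ = L^{−j}`-lattice (the scale superscript is printed);
p. 407 (Cor. 3.5): at `U = 1` this is [4] Prop. 2.2; p. 409 l. 1–5: the cube letters `G′_□(U)` «satisfy all the inequalities of Theorems
3.1–3.3».  [4] (2.67) p. 234, fourth and fifth entries: «‖ζ∇^ηG′λ‖_α, ‖ζG′∇^{η*}λ‖_α ≦ O(1)(L^jη)^{1−α}(‖ζ‖_α + |ζ|)e^{−δ₀d(y,y′)}|λ|».

## WHAT THIS FILE CERTIFIES (kernel-checked; lattice units; setting of `B9CubeSequence408`, weights `wCube` of file 2 v1.1 §4)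

For every member `D` (odd `L ≥ 2`, odd `M_h ≥ 3`, `R ≥ 2L`, `P ≥ 4`), every cover cube `q`, the cube family `cubeFam D q …` and its letter
`G′_□(1) = GpCubeW D q … = gmlT(cubeFam, wCube)`:
* **`thm31_cubeW_flat_fourth_unif`** — (3.43), first entry: there are `δ₀, M₀ > 0`, `N₀ ≥ 1` (functions of `d, L` — NOT of `α`, NOT of the
  member or the cube) and for every `0 ≤ α < 1` a `C_α > 0` such that, for `L·M_h ≥ M₀`, `RM ≥ N₀ + 1`, every axis `μ`, every `λ` with
  `supp λ ⊂ B(y′)`, `|λ| ≤ B`, and all `x ≠ x′` of one block of the cube family: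
  `|x′−x|_T^{−α}·|((G′_□λ)(x′+e_μ) − (G′_□λ)(x′)) − ((G′_□λ)(x+e_μ) − (G′_□λ)(x))| ≤ C_α·(L^{lev_□ x})^{1−α}·e^{−(δ₀/2)d(B(x),y′)}·B`
  — `B6Prop22HolderMultiLevelTorusL0.prop22_fourth_multiLevelTorus_unif` at `(cubeFam, wCube, cCube)`;
* **`thm31_cubeW_flat_fifth_unif`** — (3.43), second entry: the same for `x ↦ (G′_□∂_μᵀλ)(x)` —
  `B6Prop22DualHolderMultiLevelTorusL0.prop22_fifth_multiLevelTorus_unif` at `(cubeFam, wCube, cCube)`.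

v1.1 (same gen; DOCSTRINGS ONLY, code byte-identical to v1 p596024): r06 LANDING SWEEP №5 — (3.43) is p.398 (×4), the quotation re-set verbatim
(«B₀(β₀)», «‖ζ‖^ξ_β», «ζ ∈ C₀^∞(Δ̃(y))»), and the scale of the certified (cut-off-free) reading SAID in HONEST SCOPE.

## HONEST SCOPE

* `U = 1`; the cube family of file 1 (single scale, mass-`a = a₀ = a₁ = 1` floor, (3.24) p. 394; its HONEST SCOPE applies verbatim).
* CUT-OFF-FREE READING (which scale?): the certified lines are Hölder quotients of `∇G′_□λ` ∕ `G′_□∂ᵀλ` over the pairs `x ≠ x′` of ONE BLOCK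
  OF THE CUBE FAMILY with the torus sup-distance in LATTICE units (`η`-scale, exponent `−α`) and NO cut-off `ζ` at all — the lineage's [3] (1.9)
  form.  Print's left-hand sides carry `ζ ∈ C₀^∞(Δ̃(y))` and the factor `(‖ζ‖^ξ_β + |ζ|)` with the `ξ = L^{−j}`-scale norm of `ζ`; the passage
  from the `ζ`-free block quotient to print's `ζ`-weighted norm (Leibniz for `ζ·F` and the comparison of the `η`- and `ξ`-scale Hölder norms of
  `ζ`, a factor `(Lʲ)^{β}` — dag-n06-w2's LOCATED (L-H2), r06 PRINT WORD pub-ymgap l.26723) is NOT certified here; read as such, the certified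
  lines are the `ζ`-free core of (3.43) and imply print's display only after that (uncertified) step.
* The blocks, levels and distance are the cube family's (= the member's near □, file 1 `lev_cubeFam_eq_of_nearH`, file 1b `B9CubeCoarsening`).
* Nothing is inferred from the manuscript: two instantiations, kernel-checked.  NOT summit progress; the YM mass gap is not proved by any of this.
-/

namespace Literature.MathematicalPhysics.QuantumFieldTheory.Balaban1983to89.B9Thm31HolderCubeLocalFlat

open Literature.MathematicalPhysics.QuantumFieldTheory.Balaban1983to89.B4Reflection242 (boxDom)
open Literature.MathematicalPhysics.QuantumFieldTheory.Balaban1983to89.B4TorusKernel.MultiPeriod (torusSupNorm)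
open Literature.MathematicalPhysics.QuantumFieldTheory.Balaban1983to89.B6MultiLevelBoxOperator (N0)
open Literature.MathematicalPhysics.QuantumFieldTheory.Balaban1983to89.B6MultiLevelTorusOperator (tshift unitVec)
open Literature.MathematicalPhysics.QuantumFieldTheory.Balaban1983to89.B6Cover236MultiLevelBlocks (cubes)
open Literature.MathematicalPhysics.QuantumFieldTheory.Balaban1983to89.B6Geom246MultiLevelBoxL0 (bset blkOf)
open Literature.MathematicalPhysics.QuantumFieldTheory.Balaban1983to89.B6Geom246MultiLevelTorusL0 (geomT)
open Literature.MathematicalPhysics.QuantumFieldTheory.Balaban1983to89.B6RandomWalk (BlockSupp)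
open Literature.MathematicalPhysics.QuantumFieldTheory.Balaban1983to89.B6Prop22DerivMultiLevelTorus (dT)
open Literature.MathematicalPhysics.QuantumFieldTheory.Balaban1983to89.B6Prop22HolderMultiLevelTorusL0 (prop22_fourth_multiLevelTorus_unif)
open Literature.MathematicalPhysics.QuantumFieldTheory.Balaban1983to89.B6Prop22DualHolderMultiLevelTorusL0 (prop22_fifth_multiLevelTorus_unif)
open Literature.MathematicalPhysics.QuantumFieldTheory.Balaban1983to89.B9CubeSequence408 (cubeFam)
open Literature.MathematicalPhysics.QuantumFieldTheory.Balaban1983to89.B9Thm31CubeLocalFlat (wCube cCube wCube_window cCube_window wCube_rec amin_pos GpCubeW)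
open scoped Matrix

variable {d : ℕ}

/-- **(3.43)₁ AT `U = 1` FOR `G′_□`, `α`-UNIFORM RATE** (weights `wCube`): the Hölder quotient of the forward differences of `G′_□(1)λ` over the pairs
of one block of the cube family — `prop22_fourth_multiLevelTorus_unif` at `(cubeFam, wCube, cCube)`.
[cite: Balaban1985BackgroundPropagators, Thm 3.1 p.397, (3.43) p.398 (first entry) with Cor. 3.5 p.407 and p.409 l.1–5; Balaban1984PropagatorsII, Prop. 2.2 (2.67) p.234 (fourth entry), (2.64)–(2.66) p.234] -/
theorem thm31_cubeW_flat_fourth_unif (d ℓ : ℕ) (hℓ : 1 ≤ ℓ) :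
    ∃ δ₀ M₀ : ℝ, ∃ N₀ : ℕ, 0 < δ₀ ∧ 0 < M₀ ∧ 0 < N₀ ∧ ∀ (α : ℝ), 0 ≤ α → α < 1 → ∃ C : ℝ, 0 < C ∧
      ∀ {Mh k R : ℕ} {P : Fin (d + 1) → ℕ} (D : B6MultiLevelTorusOperator.TDomains d ℓ Mh k P R)
        (q : ↥(cubes D.toDomains)) (hL : Odd (ℓ + 1)) (hM : Odd Mh) (hMh : 1 ≤ Mh) (hP : ∀ μ, 1 ≤ P μ),
        3 ≤ Mh → M₀ ≤ ((ℓ : ℝ) + 1) * Mh → 2 * (ℓ + 1) ≤ R → N₀ + 1 ≤ R * ((ℓ + 1) * Mh) → (∀ μ, 4 ≤ P μ) →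
        ∀ (μ : Fin (d + 1)) (y' : ↥(bset (cubeFam D q hL hM hMh hP).toDomains)) (lam : ↥(boxDom (N0 ℓ Mh k P)) → ℝ) (B : ℝ),
          BlockSupp (g := geomT (cubeFam D q hL hM hMh hP)) (blkOf (cubeFam D q hL hM hMh hP).toDomains) lam y' B →
          ∀ (x x' : ↥(boxDom (N0 ℓ Mh k P))), x'.1 ≠ x.1 →
            blkOf (cubeFam D q hL hM hMh hP).toDomains x' = blkOf (cubeFam D q hL hM hMh hP).toDomains x →
            (torusSupNorm (N0 ℓ Mh k P) (x'.1 - x.1)) ^ (-α)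
                * |((GpCubeW D q hL hM hMh hP *ᵥ lam) (tshift (N0 ℓ Mh k P) (unitVec μ) x')
                      - (GpCubeW D q hL hM hMh hP *ᵥ lam) x')
                    - ((GpCubeW D q hL hM hMh hP *ᵥ lam) (tshift (N0 ℓ Mh k P) (unitVec μ) x)
                      - (GpCubeW D q hL hM hMh hP *ᵥ lam) x)|
              ≤ C * (((ℓ : ℝ) + 1) ^ (cubeFam D q hL hM hMh hP).lev x.1) ^ (1 - α)
                * Real.exp (-(δ₀ / 2 * (geomT (cubeFam D q hL hM hMh hP)).dist
                    (blkOf (cubeFam D q hL hM hMh hP).toDomains x) y')) * B := by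
  obtain ⟨δ₀, M₀, N₀, hδ₀, hM₀, hN₀, h⟩ :=
    prop22_fourth_multiLevelTorus_unif d ℓ hℓ (1 - ((((ℓ : ℝ) + 1)) ^ 2)⁻¹) 1 1 (1 - ((((ℓ : ℝ) + 1)) ^ 2)⁻¹)⁻¹
      (amin_pos hℓ) one_pos
  refine ⟨δ₀, M₀, N₀, hδ₀, hM₀, hN₀, fun α hα0 hα1 => ?_⟩
  obtain ⟨C, hC, h'⟩ := h α hα0 hα1
  refine ⟨C, hC, ?_⟩
  intro Mh k R P D q hL hM hMh hP h3 hM0 hR hN0 hP4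
  exact h' k Mh R h3 hM0 hR hN0 P hP hP4 (cubeFam D q hL hM hMh hP) (wCube ℓ) (cCube ℓ) (wCube_window hℓ) (cCube_window hℓ)
    (wCube_rec hℓ)

/-- **(3.43)₂ AT `U = 1` FOR `G′_□`, `α`-UNIFORM RATE** (weights `wCube`): the Hölder quotient of `G′_□(1)∂_μᵀλ` over the pairs of one block of
the cube family — `prop22_fifth_multiLevelTorus_unif` at `(cubeFam, wCube, cCube)`.
[cite: Balaban1985BackgroundPropagators, Thm 3.1 p.397, (3.43) p.398 (second entry) with Cor. 3.5 p.407 and p.409 l.1–5; Balaban1984PropagatorsII, Prop. 2.2 (2.67) p.234 (fifth entry), (2.64)–(2.66) p.234] -/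
theorem thm31_cubeW_flat_fifth_unif (d ℓ : ℕ) (hℓ : 1 ≤ ℓ) :
    ∃ δ₀ M₀ : ℝ, ∃ N₀ : ℕ, 0 < δ₀ ∧ 0 < M₀ ∧ 0 < N₀ ∧ ∀ (α : ℝ), 0 ≤ α → α < 1 → ∃ C : ℝ, 0 < C ∧
      ∀ {Mh k R : ℕ} {P : Fin (d + 1) → ℕ} (D : B6MultiLevelTorusOperator.TDomains d ℓ Mh k P R)
        (q : ↥(cubes D.toDomains)) (hL : Odd (ℓ + 1)) (hM : Odd Mh) (hMh : 1 ≤ Mh) (hP : ∀ μ, 1 ≤ P μ),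
        3 ≤ Mh → M₀ ≤ ((ℓ : ℝ) + 1) * Mh → 2 * (ℓ + 1) ≤ R → N₀ + 1 ≤ R * ((ℓ + 1) * Mh) → (∀ μ, 4 ≤ P μ) →
        ∀ (μ : Fin (d + 1)) (y' : ↥(bset (cubeFam D q hL hM hMh hP).toDomains)) (lam : ↥(boxDom (N0 ℓ Mh k P)) → ℝ) (B : ℝ),
          BlockSupp (g := geomT (cubeFam D q hL hM hMh hP)) (blkOf (cubeFam D q hL hM hMh hP).toDomains) lam y' B →
          ∀ (x x' : ↥(boxDom (N0 ℓ Mh k P))), x'.1 ≠ x.1 →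
            blkOf (cubeFam D q hL hM hMh hP).toDomains x' = blkOf (cubeFam D q hL hM hMh hP).toDomains x →
            (torusSupNorm (N0 ℓ Mh k P) (x'.1 - x.1)) ^ (-α)
                * |((GpCubeW D q hL hM hMh hP * (dT (N0 ℓ Mh k P) μ).transpose) *ᵥ lam) x'
                    - ((GpCubeW D q hL hM hMh hP * (dT (N0 ℓ Mh k P) μ).transpose) *ᵥ lam) x|
              ≤ C * (((ℓ : ℝ) + 1) ^ (cubeFam D q hL hM hMh hP).lev x.1) ^ (1 - α)
                * Real.exp (-(δ₀ / 2 * (geomT (cubeFam D q hL hM hMh hP)).dist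
                    (blkOf (cubeFam D q hL hM hMh hP).toDomains x) y')) * B := by
  obtain ⟨δ₀, M₀, N₀, hδ₀, hM₀, hN₀, h⟩ :=
    prop22_fifth_multiLevelTorus_unif d ℓ hℓ (1 - ((((ℓ : ℝ) + 1)) ^ 2)⁻¹) 1 1 (1 - ((((ℓ : ℝ) + 1)) ^ 2)⁻¹)⁻¹
      (amin_pos hℓ) one_pos
  refine ⟨δ₀, M₀, N₀, hδ₀, hM₀, hN₀, fun α hα0 hα1 => ?_⟩
  obtain ⟨C, hC, h'⟩ := h α hα0 hα1
  refine ⟨C, hC, ?_⟩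
  intro Mh k R P D q hL hM hMh hP h3 hM0 hR hN0 hP4
  exact h' k Mh R h3 hM0 hR hN0 P hP hP4 (cubeFam D q hL hM hMh hP) (wCube ℓ) (cCube ℓ) (wCube_window hℓ) (cCube_window hℓ)
    (wCube_rec hℓ)

end Literature.MathematicalPhysics.QuantumFieldTheory.Balaban1983to89.B9Thm31HolderCubeLocalFlat
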